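import Summits.NavierStokesRegularity.NavierStokesRegularity.Theses.QuantisedSymmetry
import Summits.NavierStokesRegularity.NavierStokesRegularity.Theorems.QuantisedSymmetryLiouvilleKillsProfile
import Summits.NavierStokesRegularity.NavierStokesRegularity.Theorems.QuantisedSymmetryPolyhedralDssProfileExistsDominatesBlowupProfile
import Summits.NavierStokesRegularity.NavierStokesRegularity.Theorems.QuantisedSymmetryPolyhedralDssProfileExistsStubNoSmallConstant
import HarnessLib

/-!
# Strategist sketch S21-g12 (family `s`, independent census) — crux `PolyhedralDssProfileExists`
# (X⁻, stmt-NavierStokesRegularity-1404), route `QuantisedSymmetry`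

Typed companion of `STRATEGY-CENSUS-s21.md` (strategist seat `cstrat-stmt-NavierStokesRegularity-1404-s21-g12`).
Sorry-free bookkeeping only; nothing here is a line or a stub.  It records, over the tree's declarations:

* `TypeIDssProfileExists` — the weaker intermediate W_a (drop the group): a Type-I `λ`-DSS nontrivial ancient
  mild profile for some `λ > 1`; `X → W_a`, `W_a ↔ ∃ λ > 1, ¬ TypeIDSSLiouville λ`, and `X → Blowup.BlowupTypeIDssProfile`
  (stmt-0155) by the landed `stub_dominatesBlowupProfile`.  W_a still decides the summit negatively (the truncation
  bridge `FilamentSkeletonRss.RdssProfileTruncation` is proved for every profile), is an open crux of route `Blowup`,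
  and has no existence mechanism: replacing X by W_a removes the route's only lever and adds no tool.
* `EquivariantTypeIAncientExists` — the weaker intermediate W_f (drop periodicity, keep the sector): a nontrivial
  polyhedrally-equivariant bounded ancient mild solution with Type-I decay; `W_f ↔ ¬ PolyhedralTypeILiouville`
  (the route's kill switch #3, stmt-1405) and `X → W_f` (via the landed `quantisedSymmetry_liouvilleKillsProfile_proof`).
* the only typed decomposition the census could produce, `X_of_subs : W_f → ClosingToDss → X`, with its defect
  recorded as `closingToDss_of_X : X → ClosingToDss` (the seam is implied by X; the open half W_f has no plan).
* `profile_constant_gt` — every witness of X (indeed of W_a) has Type-I constant `C₀ > ε₀` (Chae–Wolf gap, landed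
  `stub_noSmallConstant`): no bifurcation from the trivial profile can start a construction.
-/

set_option linter.dupNamespace false

namespace Summit.NavierStokesRegularity.NavierStokesRegularity.Cruxes.PolyhedralDssProfileExists.StrategistS21g12

open MeasureTheory
open Literature.Analysis.FluidPDE
open _root_.Summit.NavierStokesRegularity.NavierStokesRegularity.Theses

/-- The crux under census, by name. -/
abbrev X : Prop := QuantisedSymmetry.PolyhedralDssProfileExists

/-! ## W_a — drop the symmetry group -/

/-- **W_a** (weaker intermediate, family-s step 1): for some `λ > 1` there is a nontrivial ancient mild solution
(`ν = 1`, measurable slices) which is `λ`-DSS and has Type-I decay `|u| ≤ C₀/(|x|+√(−t))` — X with the three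
group-theoretic clauses deleted.  Equivalent to `∃ λ > 1, ¬ TypeIDSSLiouville λ` (`typeIDssProfileExists_iff`). -/
def TypeIDssProfileExists : Prop :=
  ∃ c : ℝ, 1 < c ∧ ∃ u : ℝ → EuclideanSpace ℝ (Fin 3) → EuclideanSpace ℝ (Fin 3),
    IsAncientMildSolution 1 u ∧ (∀ t < 0, AEStronglyMeasurable (u t) volume) ∧
      IsDiscretelySelfSimilar c u ∧ (∃ C₀ : ℝ, HasTypeIDecay C₀ u) ∧ ¬ (∀ t < 0, u t =ᵐ[volume] 0)

/-- X ⇒ W_a: forget the group. -/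
theorem typeIDssProfileExists_of_X (hX : X) : TypeIDssProfileExists := by
  obtain ⟨G, -, -, -, c, hc, u, hanc, hmeas, hdss, hdec, -, hnt⟩ := hX
  exact ⟨c, hc, u, hanc, hmeas, hdss, hdec, hnt⟩

/-- W_a is literally the failure of Tsai's Type-I `λ`-DSS Liouville statement at some factor `λ > 1`. -/
theorem typeIDssProfileExists_iff :
    TypeIDssProfileExists ↔ ∃ c : ℝ, 1 < c ∧ ¬ TypeIDSSLiouville c := by
  constructor
  · rintro ⟨c, hc, u, hanc, hmeas, hdss, hdec, hnt⟩
    exact ⟨c, hc, fun hL => hnt (hL hc u hanc hmeas hdss hdec)⟩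
  · rintro ⟨c, hc, hL⟩
    refine ⟨c, hc, ?_⟩
    by_contra hne
    apply hL
    intro _ u hanc hmeas hdss hdec
    by_contra hnt
    exact hne ⟨u, hanc, hmeas, hdss, hdec, hnt⟩

/-- X ⇒ stmt-0155 (`Blowup.BlowupTypeIDssProfile`, the sector-agnostic existence crux of route `Blowup`):
the landed registered stub `stub_dominatesBlowupProfile` of line `polyhedral_cell`. -/
theorem blowupTypeIDssProfile_of_X (hX : X) : Blowup.BlowupTypeIDssProfile :=
  _root_.Summit.NavierStokesRegularity.NavierStokesRegularity.Theorems.PolyhedralDssProfileExists.PolyhedralCell.stub_dominatesBlowupProfile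
    hX

/-! ## W_f — drop periodicity, keep the sector -/

/-- **W_f** (weaker intermediate, "recurrent habitat"): some finite irreducible proper rotation group `G` and some
NONTRIVIAL bounded ancient mild solution (`ν = 1`, measurable slices) with Type-I decay which is `G`-equivariant
about the origin.  No DSS clause: the Leray orbit need not be periodic. -/
def EquivariantTypeIAncientExists : Prop :=
  ∃ G : Subgroup (EuclideanSpace ℝ (Fin 3) ≃ₗᵢ[ℝ] EuclideanSpace ℝ (Fin 3)), Finite G ∧
    (∀ g ∈ G, LinearMap.det (g.toLinearEquiv :
      EuclideanSpace ℝ (Fin 3) →ₗ[ℝ] EuclideanSpace ℝ (Fin 3)) = 1) ∧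
    (∀ V : Submodule ℝ (EuclideanSpace ℝ (Fin 3)), (∀ g ∈ G, ∀ v ∈ V, g v ∈ V) → V = ⊥ ∨ V = ⊤) ∧
    ∃ u : ℝ → EuclideanSpace ℝ (Fin 3) → EuclideanSpace ℝ (Fin 3),
      IsBoundedAncientMildSolution 1 u ∧ (∀ t < 0, AEStronglyMeasurable (u t) volume) ∧
        (∃ C₀ : ℝ, HasTypeIDecay C₀ u) ∧ (∀ g ∈ G, ∀ t x, u t (g x) = g (u t x)) ∧
          ¬ (∀ t < 0, u t =ᵐ[volume] 0)

/-- W_f is exactly the negation of the route's kill switch #3 `PolyhedralTypeILiouville` (stmt-1405). -/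
theorem equivariantTypeIAncientExists_iff_not_liouville :
    EquivariantTypeIAncientExists ↔ ¬ QuantisedSymmetry.PolyhedralTypeILiouville := by
  constructor
  · rintro ⟨G, hfin, hdet, hirr, u, hb, hm, hdec, heq, hnt⟩ hL
    exact hnt (hL G hfin hdet hirr u hb hm hdec heq)
  · intro h
    by_contra hne
    apply h
    intro G hfin hdet hirr u hb hm hdec heq
    by_contra hnt
    exact hne ⟨G, hfin, hdet, hirr, u, hb, hm, hdec, heq, hnt⟩

/-- X ⇒ ¬#3: the landed glue `LiouvilleKillsProfile` (stmt-1408) read contrapositively. -/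
theorem not_polyhedralTypeILiouville_of_X (hX : X) : ¬ QuantisedSymmetry.PolyhedralTypeILiouville :=
  fun hL => _root_.Summit.NavierStokesRegularity.NavierStokesRegularity.Theorems.quantisedSymmetry_liouvilleKillsProfile_proof
    hL hX

/-- X ⇒ W_f (time shift `t ↦ t − 1` makes the profile bounded; packaged through ¬#3). -/
theorem equivariantTypeIAncientExists_of_X (hX : X) : EquivariantTypeIAncientExists :=
  equivariantTypeIAncientExists_iff_not_liouville.mpr (not_polyhedralTypeILiouville_of_X hX)

/-! ## The only typed decomposition: habitat + closing lemma -/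

/-- **Closing seam** (decomposition D1, piece 2): every polyhedral Type-I ancient habitat contains a periodic
Leray orbit — "recurrent ⇒ periodic" for Leray's similarity flow in the sector.  No PDE closing lemma of this
kind is known (Pugh-type closing perturbs the vector field; Navier–Stokes is fixed). -/
def ClosingToDss : Prop := EquivariantTypeIAncientExists → X

/-- Assembly of D1 (modus ponens): W_f → ClosingToDss → X. -/
theorem X_of_subs (h₁ : EquivariantTypeIAncientExists) (h₂ : ClosingToDss) : X := h₂ h₁

/-- Defect of D1 recorded honestly: the seam is implied by X itself (informational flag `trivial_seam`; the
open half W_f carries all the difficulty and has no plan). -/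
theorem closingToDss_of_X (hX : X) : ClosingToDss := fun _ => hX

/-! ## Gap at the trivial profile -/

/-- **Every witness is large**: there is `ε₀ > 0` such that any nontrivial ancient mild solution with measurable
slices and Type-I decay constant `C₀` has `ε₀ < C₀` (Chae–Wolf ε-regularity, landed `stub_noSmallConstant`).
In particular no construction of X (or of W_a) can bifurcate from `u ≡ 0`. -/
theorem profile_constant_gt :
    ∃ ε₀ : ℝ, 0 < ε₀ ∧ ∀ (u : ℝ → EuclideanSpace ℝ (Fin 3) → EuclideanSpace ℝ (Fin 3)) (C₀ : ℝ),
      IsAncientMildSolution 1 u → (∀ t < 0, AEStronglyMeasurable (u t) volume) → HasTypeIDecay C₀ u →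
        ¬ (∀ t < 0, u t =ᵐ[volume] 0) → ε₀ < C₀ := by
  obtain ⟨ε, hε, h⟩ :=
    _root_.Summit.NavierStokesRegularity.NavierStokesRegularity.Theorems.PolyhedralDssProfileExists.PolyhedralCell.stub_noSmallConstant
  exact ⟨ε, hε, fun u C₀ ha hm hd hnt => lt_of_not_ge fun hle => hnt (h u C₀ ha hm hd hle)⟩

/-- Corollary for the crux: the Type-I constant of any witness of X exceeds `ε₀`. -/
theorem X_witness_constant_gt :
    ∃ ε₀ : ℝ, 0 < ε₀ ∧ ∀ (G : Subgroup (EuclideanSpace ℝ (Fin 3) ≃ₗᵢ[ℝ] EuclideanSpace ℝ (Fin 3))) (c C₀ : ℝ)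
      (u : ℝ → EuclideanSpace ℝ (Fin 3) → EuclideanSpace ℝ (Fin 3)),
      IsAncientMildSolution 1 u → (∀ t < 0, AEStronglyMeasurable (u t) volume) → IsDiscretelySelfSimilar c u →
        HasTypeIDecay C₀ u → (∀ g ∈ G, ∀ t x, u t (g x) = g (u t x)) → ¬ (∀ t < 0, u t =ᵐ[volume] 0) →
          ε₀ < C₀ := by
  obtain ⟨ε, hε, h⟩ := profile_constant_gt
  exact ⟨ε, hε, fun _ _ C₀ u ha hm _ hd _ hnt => h u C₀ ha hm hd hnt⟩

end Summit.NavierStokesRegularity.NavierStokesRegularity.Cruxes.PolyhedralDssProfileExists.StrategistS21g12
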